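import Summits.BirchSwinnertonDyer.BirchSwinnertonDyer.Theorems.AdditiveKolyvaginRoadKolyvaginTransverseLagrangian
import Summits.BirchSwinnertonDyer.BirchSwinnertonDyer.Theorems.AdditiveKolyvaginRoadKolyvaginLocalH1Card
import Summits.BirchSwinnertonDyer.BirchSwinnertonDyer.Theorems.KolyvaginRoadThreeZhangSupplyOrdinaryLagrangian
import HarnessLib

/-!
# Route `AdditiveKolyvaginRoad`, crux `KolyvaginPrimitiveAdditive` (item stmt-BirchSwinnertonDyer-20132):
# stub LOC, towards (Supply) at a general odd prime `p` — (Lag-tr), the COUNT clause: `#H¹_tr(K_λ, E[p]) = p²`, so the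
# genuine transverse condition at a Kolyvagin prime is LAGRANGIAN (p-generic port of koly3b's `…ZhangSupplyTransverseCount`
# §4 and of the isotropic count bound of `…ZhangSupplyOrdinaryLagrangian`, `3 ↦ p¹`)
# (cell `pub/bsd-wall`, lead prover `bsd-wall-akr-p1` g3; `--supports stmt-BirchSwinnertonDyer-20132`, helper)

WHY THIS FILE. With `htrIncl` ∕ `htrIso` (`…KolyvaginTransverseLagrangian`) and `#H¹(K_λ, E[p]) = p⁴`
(`…KolyvaginLocalH1Card`), the count `#Ltr · #Ltr = #H¹(K_λ, E[p])` makes the transverse condition at the Kolyvagin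
primes `λ' ∈ T` a Lagrangian local condition — the (Lag-tr) input of the unsigned jump `hjump_of_localLagrangians` of
the GLOBAL half of (Supply) (PORT MAP in HOME/bsd-wall-akr-p1/NOTES_g3.md).

WHAT. `natCard_mul_natCard_le_of_isotropic_P` (an isotropic local condition has `#L · #L ≤ #H¹(K_v, E[p])`: local Tate
duality for the Poitou–Tate family of the totally complex `K`), `nsmul_eq_nsmul_of_modEq_P`, and
`htrCard_transverseLocalCondition_P`: UPPER `#Ltr ≤ p²` by isotropy; LOWER the `p²` classes `s ↦ k(s) • Q`, `Q ∈ E[p]`,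
`χ s = χ σ₁ ^ k(s)` for the generator `χ σ₁` of order `ℓ + 1 ≡ 0 (mod p)` (`exists_kolyvagin_character_P`), vanishing
on `ker χ = res⁻¹(Stab K[ℓ])`, pairwise non-cohomologous.

HONEST FRAMING: theorems only; 0 definitions, 0 named facts, 0 `sorry`; closes nothing.

References: [cite: WZhang2014, §8.1 (dim H¹_tr = 2)] [cite: GrossLMS1991, §3–§4] [cite: MilneADT2006, Ch. I, Cor. 2.3,
Thm. 2.8] [cite: PoonenRains2012, Prop. 4.10].
-/

-- single-conjunct summit: `Summit.BirchSwinnertonDyer.BirchSwinnertonDyer.…` repeats the name by design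
set_option linter.dupNamespace false

noncomputable section

open scoped Classical Pointwise

universe u

namespace Summit.BirchSwinnertonDyer.BirchSwinnertonDyer.Theorems.AdditiveKoly

open CategoryTheory WeierstrassCurve Field Function NumberField IsDedekindDomain
open Literature.NumberTheory.EllipticCurves Literature.NumberTheory.EllipticCurves.ModularForms
  Literature.NumberTheory.GaloisRepresentations Module
open Literature.NumberTheory.GaloisRepresentations.DiscreteGaloisModule (mu MuCarrier)
open Literature.NumberTheory.GaloisCohomology
open Summit.BirchSwinnertonDyer.Rank1Residual.X11b.Three.Koly.Method2
open Summit.BirchSwinnertonDyer.Rank1Residual.X11b.Three.Koly.Method2.KolyLocal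
open Summit.BirchSwinnertonDyer.Rank1Residual.X11b.Three.Koly.ZhangSupply
open Summit.BirchSwinnertonDyer.Rank1Residual.X11b.FiniteDuality
open Summit.BirchSwinnertonDyer.Rank1Residual.X11b.Relaxation
open Summit.BirchSwinnertonDyer.Rank1Residual.GaloisImage
open Summit.BirchSwinnertonDyer.Rank1Residual.JET Summit.BirchSwinnertonDyer.Rank1Residual.X11b
open scoped ContRepresentation

variable (W : WeierstrassCurve ℚ) (K : Type) [Field K] [NumberField K] (p : ℕ) [W.IsElliptic] [W.IsGloballyMinimal]
  [Fact p.Prime] [∀ v : Place K, CompactSpace (absoluteGaloisGroup (Place.Completion v))]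

/-! ## §1 The isotropic count bound -/

omit [W.IsGloballyMinimal] in
/-- **An isotropic local condition at a finite place has `#L · #L ≤ #H¹(K_v, E[p])`** (isotropy `L ≤ L^⊥` for the local
Tate pairing `inv_v ∘ ∪_e` of a Poitou–Tate family of the totally complex `K`, and `#L^⊥ · #L = #H¹`); koly3b's
`natCard_mul_natCard_le_of_isotropic` with `3 ↦ p¹`. [cite: MilneADT2006, Ch. I, Cor. 2.3] [cite: PoonenRains2012, Prop. 4.10] -/
theorem natCard_mul_natCard_le_of_isotropic_P (hK : IsImaginaryQuadratic K) (v : HeightOneSpectrum (𝓞 K))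
    (Lv : AddSubgroup (galoisCohomology (((W.baseChange K).torsionGaloisModule ((p ^ 1 : ℕ) : ℤ)).toLocal
      (Sum.inr v)) 1))
    (hiso : ∀ (e : geomTorsion (W.baseChange K) ((p ^ 1 : ℕ) : ℤ) → geomTorsion (W.baseChange K) ((p ^ 1 : ℕ) : ℤ) →
          AlgebraicClosure K)
        (hμ : ∀ P Q, e P Q ^ (p ^ 1) = 1) (hadd₁ : ∀ P₁ P₂ Q, e (P₁ + P₂) Q = e P₁ Q * e P₂ Q)
        (hadd₂ : ∀ P Q₁ Q₂, e P (Q₁ + Q₂) = e P Q₁ * e P Q₂) (_halt : ∀ Q, e Q Q = 1)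
        (_hnondeg : ∀ Q, (∀ P, e P Q = 1) → Q = 0)
        (hgal : ∀ (σ : absoluteGaloisGroup K) (P Q : geomTorsion (W.baseChange K) ((p ^ 1 : ℕ) : ℤ)),
          σ • e P Q = e (σ • P) (σ • Q)),
      ∀ a ∈ Lv, ∀ b ∈ Lv, (weilContPairingLocal (W.baseChange K) (p ^ 1) e hμ hadd₁ hadd₂ hgal (Sum.inr v)).cupProduct a b
        = 0) :
    Nat.card Lv * Nat.card Lv ≤
      Nat.card (galoisCohomology (((W.baseChange K).torsionGaloisModule ((p ^ 1 : ℕ) : ℤ)).toLocal (Sum.inr v)) 1) := by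
  have hp : p.Prime := Fact.out
  haveI : IsTotallyComplex K := hK.2
  haveI : NeZero (p ^ 1 : ℕ) := ⟨pow_ne_zero 1 hp.ne_zero⟩
  haveI := KummerPT.finite_galoisCohomology_toLocal_inr (W.baseChange K) (p ^ 1) v
  obtain ⟨e, hμ, hadd₁, hadd₂, halt, hnondeg, hgal⟩ :=
    exists_weilPairing_holds (W.baseChange K) (p ^ 1) (by rw [pow_one]; exact hp.two_le) (by
      rw [pow_one]; exact_mod_cast hp.ne_zero)
  obtain ⟨inv, hinvperf, -⟩ := poitouTate_sum_localTatePairing_eq_zero_of_isTotallyComplex K (p ^ 1)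
  have hinj : Injective (inv (Sum.inr v)) := (hinvperf v).1.1
  set b := invWeilPairing (W.baseChange K) (p ^ 1) e hμ hadd₁ hadd₂ hgal inv (Sum.inr v) with hb
  have hA := KummerPT.nsmul_galoisCohomology_toLocal_eq_zero (W.baseChange K) (p ^ 1) (Sum.inr v)
  have hle : Lv ≤ annRight b Lv := fun y hy ↦ (mem_annRight_iff b Lv y).mpr fun x hx ↦ by
    rw [hb, invWeilPairing_apply, hiso e hμ hadd₁ hadd₂ halt hnondeg hgal x hx y hy]
    exact map_zero _
  have hmul : Nat.card (annRight b Lv) * Nat.card Lv =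
      Nat.card (galoisCohomology (((W.baseChange K).torsionGaloisModule ((p ^ 1 : ℕ) : ℤ)).toLocal (Sum.inr v)) 1) :=
    natCard_annRight_mul hA b (KummerPT.invWeilPairing_flip_bijective (W.baseChange K) (p ^ 1) e hμ hadd₁ hadd₂ hgal
      hnondeg inv v hinj) Lv
  calc Nat.card Lv * Nat.card Lv ≤ Nat.card (annRight b Lv) * Nat.card Lv :=
        Nat.mul_le_mul_right _ (AddSubgroup.card_le_of_le hle)
    _ = _ := hmul

/-! ## §2 The count clause `htrCard`: `p²` transverse classes -/

omit [W.IsElliptic] [W.IsGloballyMinimal] [Fact p.Prime]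
  [∀ v : Place K, CompactSpace (absoluteGaloisGroup (Place.Completion v))] in
/-- `a • Q = b • Q` for `a ≡ b (mod p)` and a `p`-torsion point. [folklore] -/
theorem nsmul_eq_nsmul_of_modEq_P {P : geomTorsion (W.baseChange K) ((p ^ 1 : ℕ) : ℤ)} {a b : ℕ}
    (h : a ≡ b [MOD p]) : a • P = b • P := by
  have hn : p • P = 0 := by
    have h1 : (p ^ 1) • P = 0 := by
      have := AddSubgroup.torsionBy.nsmul P
      exact_mod_cast this
    exact (congrArg (fun k : ℕ ↦ k • P) (pow_one p)).symm.trans h1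
  have key : ∀ c : ℕ, c • P = (c % p) • P := fun c ↦ by
    conv_lhs => rw [← Nat.mod_add_div c p, add_nsmul, mul_nsmul, hn, nsmul_zero, add_zero]
  rw [key a, key b, h]

/-- **(Lag-tr), count clause `htrCard`** at a general odd prime `p`: at a Kolyvagin prime `λ` (with `d_K < −4`),
`#Ltr · #Ltr = #H¹(K_λ, E[p])` (`= p⁴`). UPPER: isotropy (`htrIso_transverseLocalCondition_P`) and §1 give `#Ltr ≤ p²`.
LOWER: the `p²` classes `s ↦ k(s) • Q` (`Q ∈ E[p]`), where `χ s = χ σ₁ ^ k(s)` for the generator `χ σ₁` of order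
`ℓ + 1 ≡ 0 (mod p)` of `χ(Γ_{K_λ})` (`exists_kolyvagin_character_P`); they vanish on `ker χ = res⁻¹(Stab K[ℓ])`, are
pairwise non-cohomologous (value `Q` at `σ₁`; coboundaries vanish), and `#E[p] = p²`. [cite: WZhang2014, §8.1]
[cite: GrossLMS1991, §3–§4] [cite: MilneADT2006, Ch. I, Thm. 2.8] -/
theorem htrCard_transverseLocalCondition_P (hK : IsImaginaryQuadratic K) (hp2 : p ≠ 2) (hd : NumberField.discr K < -4)
    (ι : K →+* ℂ) {ℓ : ℕ} (hℓ : Zhang2014.IsKolyvaginPrime (W.conductorNorm ℤ) W K p ℓ) (v : HeightOneSpectrum (𝓞 K))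
    (hv : (ℓ : 𝓞 K) ∈ v.asIdeal) :
    Nat.card (transverseLocalCondition (W.baseChange K) ι ℓ (v.adicCompletion K) ((p ^ 1 : ℕ) : ℤ)) *
        Nat.card (transverseLocalCondition (W.baseChange K) ι ℓ (v.adicCompletion K) ((p ^ 1 : ℕ) : ℤ)) =
      Nat.card (galoisCohomology (((W.baseChange K).torsionGaloisModule ((p ^ 1 : ℕ) : ℤ)).toLocal (Sum.inr v)) 1) := by
  have hp : p.Prime := Fact.out
  haveI : NeZero (p ^ 1 : ℕ) := ⟨pow_ne_zero 1 hp.ne_zero⟩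
  haveI hfinH : Finite (galoisCohomology (GaloisRep.restrictField (v.adicCompletion K)
      ((W.baseChange K).torsionGaloisModule ((p ^ 1 : ℕ) : ℤ))) 1) :=
    KummerPT.finite_galoisCohomology_toLocal_inr (W.baseChange K) (p ^ 1) v
  set Kv := v.adicCompletion K with hKv
  set Lv := transverseLocalCondition (W.baseChange K) ι ℓ Kv ((p ^ 1 : ℕ) : ℤ) with hLv
  have h81 := natCard_galoisCohomology_one_toLocal_eq_of_kolyvagin_P W K p hK hℓ v hv
  have h3ℓ : p ∣ ℓ + 1 := (Zhang2014.IsKolyvaginPrime.dvd (p := p) hℓ).1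
  -- upper bound
  have hle : Nat.card Lv ≤ (p ^ 1) ^ 2 := by
    have h := natCard_mul_natCard_le_of_isotropic_P W K p hK v Lv
      (fun e hμ hadd₁ hadd₂ _ _ hgal ↦ htrIso_transverseLocalCondition_P W K p hK hp2 hd ι hℓ v hv e hμ hadd₁ hadd₂ hgal)
    rw [h81, sq ((p ^ 1) ^ 2)] at h
    exact Nat.mul_self_le_mul_self_iff.mp h
  -- lower bound: the `p²` classes `s ↦ k(s) • Q`
  obtain ⟨𝔐, h𝔐, χ, σ₁, hfix, -, hker, hlc, hgen, hord⟩ := exists_kolyvagin_character_P W K p hK hd ι hℓ v hv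
  let kOf : ringClassGal ι ℓ → ℕ := fun g ↦ if h : ∃ i : ℕ, g = χ σ₁ ^ i then Classical.choose h else 0
  let k : absoluteGaloisGroup Kv → ℕ := fun s ↦ kOf (χ s)
  have hk : ∀ s, χ s = χ σ₁ ^ k s := fun s ↦ by
    have hex : ∃ i : ℕ, χ s = χ σ₁ ^ i := hgen s
    have h := Classical.choose_spec hex
    simp only [k, kOf, dif_pos hex]
    exact h
  have hkmul : ∀ s t, k (s * t) ≡ k s + k t [MOD p] := fun s t ↦ by
    refine Nat.ModEq.of_dvd h3ℓ ?_
    rw [← hord, ← pow_eq_pow_iff_modEq, ← hk, map_mul, hk s, hk t, pow_add]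
  have hk1 : k σ₁ ≡ 1 [MOD p] := by
    refine Nat.ModEq.of_dvd h3ℓ ?_
    rw [← hord, ← pow_eq_pow_iff_modEq, ← hk, pow_one]
  have hk0 : ∀ s, absGaloisRestrict K Kv s ∈ ringClassStabilizer K ι ℓ ℓ → k s ≡ 0 [MOD p] := fun s hs ↦ by
    refine Nat.ModEq.of_dvd h3ℓ ?_
    rw [← hord, ← pow_eq_pow_iff_modEq, ← hk, pow_zero]
    exact (hker s).mpr hs
  have hlck : ∀ Q : geomTorsion (W.baseChange K) ((p ^ 1 : ℕ) : ℤ), IsLocallyConstant fun s ↦ k s • Q := fun Q ↦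
    hlc.comp fun g ↦ kOf g • Q
  have hfix' : ∀ (τ : absoluteGaloisGroup Kv) (m : ℕ) (Q : geomTorsion (W.baseChange K) ((p ^ 1 : ℕ) : ℤ)),
      absGaloisRestrict K Kv τ • (m • Q) = m • Q := fun τ m Q ↦ by rw [smul_comm, hfix]
  -- the cocycle `θ_Q`
  let θ : geomTorsion (W.baseChange K) ((p ^ 1 : ℕ) : ℤ) →
      contOneCocycles (DiscreteGaloisModule.toTopRep (GaloisRep.restrictField Kv
        ((W.baseChange K).torsionGaloisModule ((p ^ 1 : ℕ) : ℤ)))) := fun Q ↦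
    ⟨⟨fun s ↦ k s • Q, (hlck Q).continuous⟩, fun g h ↦ by
      change k (g * h) • Q = k g • Q + absGaloisRestrict K Kv g • (k h • Q)
      rw [hfix', ← add_nsmul]
      exact nsmul_eq_nsmul_of_modEq_P W K p (hkmul g h)⟩
  have hθ : ∀ Q s, (θ Q).1 s = k s • Q := fun _ _ ↦ rfl
  have hθmem : ∀ Q, oneCocycleClass _ (θ Q) ∈ Lv := fun Q ↦
    ⟨θ Q, fun s hs ↦ by rw [hθ, nsmul_eq_nsmul_of_modEq_P W K p (hk0 s hs), zero_nsmul], rfl⟩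
  -- injectivity of `Q ↦ [θ_Q]`
  let f : geomTorsion (W.baseChange K) ((p ^ 1 : ℕ) : ℤ) → Lv := fun Q ↦ ⟨oneCocycleClass _ (θ Q), hθmem Q⟩
  have hf : Function.Injective f := by
    intro Q Q' hQQ'
    have h : oneCocycleClass _ (θ Q) - oneCocycleClass _ (θ Q') = 0 := by
      rw [sub_eq_zero]; exact congrArg Subtype.val hQQ'
    rw [← oneCocycleClass_sub] at h
    obtain ⟨m, hm⟩ := (oneCocycleClass_eq_zero_iff _ _).mp h
    have hs := hm σ₁
    change k σ₁ • Q - k σ₁ • Q' = absGaloisRestrict K Kv σ₁ • m - m at hs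
    rw [hfix, sub_self, sub_eq_zero, nsmul_eq_nsmul_of_modEq_P W K p hk1, nsmul_eq_nsmul_of_modEq_P W K p hk1,
      one_nsmul, one_nsmul] at hs
    exact hs
  have h9 : Nat.card (geomTorsion (W.baseChange K) ((p ^ 1 : ℕ) : ℤ)) = (p ^ 1) ^ 2 :=
    card_torsionPoints_eq_sq_holds (W.baseChange K) (AlgebraicClosure K) (n := p ^ 1)
      (by exact_mod_cast pow_ne_zero 1 hp.ne_zero)
  haveI : Finite Lv := inferInstance
  have hge : (p ^ 1) ^ 2 ≤ Nat.card Lv := h9 ▸ Nat.card_le_card_of_injective f hf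
  have hcard : Nat.card Lv = (p ^ 1) ^ 2 := le_antisymm hle hge
  rw [hcard, h81, sq ((p ^ 1) ^ 2)]

end Summit.BirchSwinnertonDyer.BirchSwinnertonDyer.Theorems.AdditiveKoly

end
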